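import Summits.CriticalPhenomena.PercolationContinuityZ3.Theorems.PercNearOneGluingNoHeavyLowerTailOneCutCertGraph
import Literature.Probability.Percolation.IsoradialUniverseTransfer
import Literature.Probability.Percolation.UniquenessInfiniteCluster

/-!
# `NoHeavyLowerTail` (crux stmt-CriticalPhenomena-4575), one-cut bound at `|A| = 5`:
# the target property, its invariance under relabelling, and its closedness in the weights

Assembly layer (part 1) for `oneCut5_le_six` (prim-cert-2).  `OC5 w A o` is the one-cut bound at the
rung `|A| = 5` with `E N > 4` in slack form: `E N > 4 → (∀ a ≠ a' ∈ A, P(a ↮ a') ≤ t) → P(1 ≤ N ≤ 2) ≤ t`.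
* `OC5.of_relabel`: transport along a bijection of the vertices (`prodBernoulli_real_preimage_relabel`,
  `reachable_relabel_iff`);
* `continuous_real_of_openGraph`: `w ↦ P_w(B)` is continuous for every event of the open graph
  (it is the multilinear polynomial `ML (evT B) (xOf w)` of `…OneCutCertGraph`);
* `OC5.of_dense`: if `OC5 · A o` holds on a set of weights whose closure is everything, it holds
  everywhere (the failure set is open).

Nothing here asserts anything about the crux.
-/

namespace Summit.CriticalPhenomena.PercolationContinuityZ3.Theorems.OneCutCert

open MeasureTheory Filter Topology
open scoped BigOperators Classical
open Literature.Probability.Percolation Literature.Probability.LatticeModels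

variable {n : ℕ}

/-! ## The target property -/

/-- The one-cut bound at `|A| = 5`, `E N > 4`, for the weights `w`, relays `A`, observer `o`:
`E N > 4 → (∀ a ≠ a' ∈ A, P(a ↮ a') ≤ t) → P(1 ≤ N ≤ 2) ≤ t`. [this work] -/
def OC5 (w : Sym2 (Fin n) → unitInterval) (A : Finset (Fin n)) (o : Fin n) : Prop :=
  4 < ∑ a ∈ A, (prodBernoulli w).real (openConn o a) →
    ∀ t : ℝ, (∀ a ∈ A, ∀ a' ∈ A, a ≠ a' → (prodBernoulli w).real (openConn a a')ᶜ ≤ t) →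
      (prodBernoulli w).real {ω : BondConfig (Fin n) |
        1 ≤ (A.filter fun a => ω ∈ openConn o a).card ∧ (A.filter fun a => ω ∈ openConn o a).card ≤ 2} ≤ t

/-! ## Relabelling -/

section Relabel

variable {n' : ℕ}

/-- The weights transported along a bijection of the vertices. [this work] -/
def relabelW (σ : Fin n ≃ Fin n') (w : Sym2 (Fin n) → unitInterval) : Sym2 (Fin n') → unitInterval :=
  fun e => w ((sym2Equiv σ).symm e)

/-- The transported weights agree with `w` along `sym2Equiv σ`. [this work] -/
theorem relabelW_apply (σ : Fin n ≃ Fin n') (w : Sym2 (Fin n) → unitInterval) (e : Sym2 (Fin n)) :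
    relabelW σ w (sym2Equiv σ e) = w e := by
  unfold relabelW; rw [Equiv.symm_apply_apply]

/-- `{σ x ↔ σ y}` pulls back to `{x ↔ y}`. [folklore] -/
theorem preimage_relabel_openConn (σ : Fin n ≃ Fin n') (x y : Fin n) :
    (BondConfig.relabel (sym2Equiv σ)) ⁻¹' (openConn (σ x) (σ y)) = openConn x y := by
  ext ω
  exact reachable_relabel_iff σ ω x y

/-- Probabilities of two-point connections are transported. [folklore] -/
theorem real_openConn_relabel (σ : Fin n ≃ Fin n') (w : Sym2 (Fin n) → unitInterval) (x y : Fin n) :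
    (prodBernoulli (relabelW σ w)).real (openConn (σ x) (σ y)) = (prodBernoulli w).real (openConn x y) := by
  rw [← prodBernoulli_real_preimage_relabel (sym2Equiv σ) w (relabelW σ w) (relabelW_apply σ w),
    preimage_relabel_openConn]

/-- Probabilities of two-point cuts are transported. [folklore] -/
theorem real_compl_openConn_relabel (σ : Fin n ≃ Fin n') (w : Sym2 (Fin n) → unitInterval) (x y : Fin n) :
    (prodBernoulli (relabelW σ w)).real (openConn (σ x) (σ y))ᶜ = (prodBernoulli w).real (openConn x y)ᶜ := by
  rw [← prodBernoulli_real_preimage_relabel (sym2Equiv σ) w (relabelW σ w) (relabelW_apply σ w),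
    Set.preimage_compl, preimage_relabel_openConn]

/-- The relay count is transported. [folklore] -/
theorem filter_card_relabel (σ : Fin n ≃ Fin n') (A : Finset (Fin n)) (o : Fin n) (ω : BondConfig (Fin n)) :
    ((A.map σ.toEmbedding).filter fun a => BondConfig.relabel (sym2Equiv σ) ω ∈ openConn (σ o) a).card =
      (A.filter fun a => ω ∈ openConn o a).card := by
  rw [Finset.filter_map, Finset.card_map]
  congr 1
  refine Finset.filter_congr fun a _ => ?_
  simp only [Function.comp, Equiv.coe_toEmbedding]
  exact reachable_relabel_iff σ ω o a

/-- **`OC5` is invariant under relabelling.** [this work] -/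
theorem OC5.of_relabel (σ : Fin n ≃ Fin n') (w : Sym2 (Fin n) → unitInterval) (A : Finset (Fin n))
    (o : Fin n) (h : OC5 (relabelW σ w) (A.map σ.toEmbedding) (σ o)) : OC5 w A o := by
  intro hEN t hcut
  have hEN' : 4 < ∑ a ∈ A.map σ.toEmbedding, (prodBernoulli (relabelW σ w)).real (openConn (σ o) a) := by
    rw [Finset.sum_map]
    simp only [Equiv.coe_toEmbedding, real_openConn_relabel]
    exact hEN
  have hcut' : ∀ a ∈ A.map σ.toEmbedding, ∀ a' ∈ A.map σ.toEmbedding, a ≠ a' →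
      (prodBernoulli (relabelW σ w)).real (openConn a a')ᶜ ≤ t := by
    intro a ha a' ha' hne
    obtain ⟨x, hx, rfl⟩ := Finset.mem_map.1 ha
    obtain ⟨y, hy, rfl⟩ := Finset.mem_map.1 ha'
    simp only [Equiv.coe_toEmbedding] at hne ⊢
    rw [real_compl_openConn_relabel]
    exact hcut x hx y hy fun hxy => hne (by rw [hxy])
  have key := h hEN' t hcut'
  rw [← prodBernoulli_real_preimage_relabel (sym2Equiv σ) w (relabelW σ w) (relabelW_apply σ w)] at key
  convert key using 2
  ext ω
  simp only [Set.mem_preimage, Set.mem_setOf_eq, filter_card_relabel]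

end Relabel

/-! ## Continuity in the weights and closedness of the property -/

/-- `w ↦ P_w(B)` is continuous for every event of the open graph. [this work] -/
theorem continuous_real_of_openGraph (B : Set (Set (Sym2 (Fin n))))
    (hB : ∀ ω ω' : Set (Sym2 (Fin n)), openGraph ω = openGraph ω' → (ω ∈ B ↔ ω' ∈ B)) :
    Continuous fun w : Sym2 (Fin n) → unitInterval => (prodBernoulli w).real B := by
  have : (fun w : Sym2 (Fin n) → unitInterval => (prodBernoulli w).real B) =
      fun w => ML (evT B) (xOf w) := funext fun w => real_eq_ML w B hB
  rw [this]
  unfold ML mono xOf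
  refine continuous_finsetSum _ fun g _ => continuous_const.mul (continuous_finsetProd _ fun i _ => ?_)
  have hc : Continuous fun w : Sym2 (Fin n) → unitInterval => ((w (edgeE n i) : unitInterval) : ℝ) :=
    continuous_subtype_val.comp (continuous_apply _)
  split_ifs
  · exact hc
  · exact continuous_const.sub hc

/-- The low-count event is an event of the open graph. [folklore] -/
theorem low_of_openGraph (A : Finset (Fin n)) (o : Fin n) (ω ω' : Set (Sym2 (Fin n)))
    (h : openGraph ω = openGraph ω') :
    (ω ∈ {ω : BondConfig (Fin n) | 1 ≤ (A.filter fun a => ω ∈ openConn o a).card ∧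
        (A.filter fun a => ω ∈ openConn o a).card ≤ 2}) ↔
    (ω' ∈ {ω : BondConfig (Fin n) | 1 ≤ (A.filter fun a => ω ∈ openConn o a).card ∧
        (A.filter fun a => ω ∈ openConn o a).card ≤ 2}) := by
  have : (A.filter fun a => ω ∈ openConn o a) = A.filter fun a => ω' ∈ openConn o a :=
    Finset.filter_congr fun a _ => openConn_of_openGraph o a ω ω' h
  simp only [Set.mem_setOf_eq, this]

/-- **Closedness**: if `OC5 · A o` holds on a set of weight vectors with dense range (every `w` is a
limit of a sequence from it), then it holds for every `w` (for `A` with two distinct points). [this work] -/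
theorem OC5.of_limit (A : Finset (Fin n)) (o : Fin n) (w : Sym2 (Fin n) → unitInterval)
    (u : ℕ → Sym2 (Fin n) → unitInterval) (hu : Tendsto u atTop (𝓝 w)) (h : ∀ᶠ k in atTop, OC5 (u k) A o) :
    OC5 w A o := by
  intro hEN t hcut
  -- the maximal cut `D(v) = sup over pairs`, as a function of the weights
  set pairs := (A ×ˢ A).filter fun p : Fin n × Fin n => p.1 ≠ p.2 with hpairs
  by_cases hne : pairs.Nonempty
  · set D : (Sym2 (Fin n) → unitInterval) → ℝ := fun v =>
      pairs.sup' hne fun p => (prodBernoulli v).real (openConn p.1 p.2)ᶜ with hD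
    set L : (Sym2 (Fin n) → unitInterval) → ℝ := fun v => (prodBernoulli v).real {ω : BondConfig (Fin n) |
        1 ≤ (A.filter fun a => ω ∈ openConn o a).card ∧ (A.filter fun a => ω ∈ openConn o a).card ≤ 2} with hL
    set E : (Sym2 (Fin n) → unitInterval) → ℝ := fun v => ∑ a ∈ A, (prodBernoulli v).real (openConn o a) with hE
    have hDc : Continuous D := Continuous.finset_sup'_apply hne fun p _ =>
      continuous_real_of_openGraph _ fun ω ω' h => not_congr (openConn_of_openGraph p.1 p.2 ω ω' h)
    have hLc : Continuous L := continuous_real_of_openGraph _ (low_of_openGraph A o)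
    have hEc : Continuous E := continuous_finsetSum _ fun a _ =>
      continuous_real_of_openGraph _ (openConn_of_openGraph o a)
    -- along the sequence, eventually `E > 4`, hence `L ≤ D`
    have hev : ∀ᶠ k in atTop, L (u k) ≤ D (u k) := by
      have h4 : ∀ᶠ k in atTop, 4 < E (u k) :=
        (hEc.tendsto w).comp hu |>.eventually (lt_mem_nhds hEN)
      refine (h4.and h).mono fun k hk => ?_
      refine hk.2 hk.1 (D (u k)) fun a ha a' ha' hne' => ?_
      have hmem : (a, a') ∈ pairs := Finset.mem_filter.2 ⟨Finset.mem_product.2 ⟨ha, ha'⟩, hne'⟩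
      exact Finset.le_sup' (fun p : Fin n × Fin n => (prodBernoulli (u k)).real (openConn p.1 p.2)ᶜ) hmem
    have hlim : L w ≤ D w :=
      le_of_tendsto_of_tendsto ((hLc.tendsto w).comp hu) ((hDc.tendsto w).comp hu) hev
    refine hlim.trans (Finset.sup'_le hne _ fun p hp => ?_)
    obtain ⟨hp1, hp2⟩ := Finset.mem_filter.1 hp
    obtain ⟨ha, ha'⟩ := Finset.mem_product.1 hp1
    exact hcut p.1 ha p.2 ha' hp2
  · -- no two distinct relays: `A` has at most one point, so `E N ≤ 1 < 4`
    exfalso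
    rw [Finset.not_nonempty_iff_eq_empty] at hne
    have hcard : A.card ≤ 1 := by
      by_contra hlt
      obtain ⟨a, ha, b, hb, hab⟩ := Finset.one_lt_card.1 (not_le.1 hlt)
      have : (a, b) ∈ pairs := Finset.mem_filter.2 ⟨Finset.mem_product.2 ⟨ha, hb⟩, hab⟩
      rw [hne] at this
      exact absurd this (Finset.notMem_empty _)
    have : ∑ a ∈ A, (prodBernoulli w).real (openConn o a) ≤ 1 :=
      calc ∑ a ∈ A, (prodBernoulli w).real (openConn o a) ≤ ∑ _a ∈ A, (1 : ℝ) :=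
            Finset.sum_le_sum fun a _ => measureReal_le_one
        _ = A.card := by simp
        _ ≤ 1 := by exact_mod_cast hcard
    linarith


/-! ## Density of generic weights -/

/-- A weight vector is GENERIC if no non-diagonal weight is `0`, `1/2` or `1` (then it lies strictly
inside one of the certificate boxes). [this work] -/
def Generic (w : Sym2 (Fin n) → unitInterval) : Prop :=
  ∀ e : Sym2 (Fin n), ¬ e.IsDiag → (w e : ℝ) ≠ 0 ∧ (w e : ℝ) ≠ 1 / 2 ∧ (w e : ℝ) ≠ 1

/-- The `k`-th perturbation of a real weight: push up from below `1/2`, down from `1/2` and above. [this work] -/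
noncomputable def nudgeR (k : ℕ) (x : ℝ) : ℝ :=
  if x < 1 / 2 then x + 1 / ((k : ℝ) + 4) else x - 1 / ((k : ℝ) + 4)

/-- `1/(k+4) ≤ 1/4`. [folklore] -/
theorem one_div_add_four_le (k : ℕ) : (1 : ℝ) / ((k : ℝ) + 4) ≤ 1 / 4 := by
  apply div_le_div_of_nonneg_left <;> norm_num

/-- `1/(k+4) → 0`. [folklore] -/
theorem tendsto_one_div_add_four : Tendsto (fun k : ℕ => (1 : ℝ) / ((k : ℝ) + 4)) atTop (𝓝 0) := by
  have := (tendsto_one_div_add_atTop_nhds_zero_nat (𝕜 := ℝ)).comp (tendsto_add_atTop_nat 3)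
  refine this.congr fun k => ?_
  simp only [Function.comp]
  push_cast
  ring_nf

/-- The perturbation stays in `[0,1]`. [this work] -/
theorem nudgeR_mem (k : ℕ) (x : unitInterval) : nudgeR k (x : ℝ) ∈ unitInterval := by
  have h0 := x.2.1; have h1 := x.2.2
  have hc : (0 : ℝ) < 1 / ((k : ℝ) + 4) := by positivity
  have hc' := one_div_add_four_le k
  unfold nudgeR
  split_ifs with hx
  · exact ⟨by linarith, by linarith⟩
  · exact ⟨by linarith, by linarith⟩

/-- The `k`-th perturbation of a weight in `[0,1]`. [this work] -/
noncomputable def nudge (k : ℕ) (x : unitInterval) : unitInterval := ⟨nudgeR k (x : ℝ), nudgeR_mem k x⟩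

/-- Value of `nudge`. [this work] -/
theorem coe_nudge (k : ℕ) (x : unitInterval) : ((nudge k x : unitInterval) : ℝ) = nudgeR k (x : ℝ) := rfl

/-- The perturbations converge to the weight. [this work] -/
theorem nudge_tendsto (x : unitInterval) : Tendsto (fun k => nudge k x) atTop (𝓝 x) := by
  rw [tendsto_subtype_rng]
  simp only [coe_nudge]
  unfold nudgeR
  split_ifs
  · simpa using tendsto_const_nhds.add tendsto_one_div_add_four
  · simpa using tendsto_const_nhds.sub tendsto_one_div_add_four

/-- The perturbations are eventually generic. [this work] -/
theorem nudge_eventually_generic (x : unitInterval) :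
    ∀ᶠ k in atTop, ((nudge k x : ℝ) ≠ 0 ∧ (nudge k x : ℝ) ≠ 1 / 2 ∧ (nudge k x : ℝ) ≠ 1) := by
  have hpos : ∀ k : ℕ, (0 : ℝ) < 1 / ((k : ℝ) + 4) := fun k => by positivity
  have hle := one_div_add_four_le
  simp only [coe_nudge]
  unfold nudgeR
  by_cases hx : (x : ℝ) < 1 / 2
  · simp only [hx, if_true]
    have hev : ∀ᶠ k : ℕ in atTop, (x : ℝ) + 1 / ((k : ℝ) + 4) < 1 / 2 := by
      have h0 : Tendsto (fun k : ℕ => (x : ℝ) + 1 / ((k : ℝ) + 4)) atTop (𝓝 ((x : ℝ) + 0)) :=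
        tendsto_const_nhds.add tendsto_one_div_add_four
      rw [add_zero] at h0
      exact h0.eventually (gt_mem_nhds hx)
    refine hev.mono fun k hk => ⟨?_, ne_of_lt hk, ?_⟩
    · linarith [x.2.1, hpos k]
    · linarith
  · simp only [hx, if_false]
    rcases (not_lt.1 hx).eq_or_lt with heq | hlt
    · refine Filter.Eventually.of_forall fun k => ⟨?_, ?_, ?_⟩
      · linarith [hpos k, hle k]
      · rw [← heq]; linarith [hpos k]
      · linarith [x.2.2, hpos k]
    · have hev : ∀ᶠ k : ℕ in atTop, 1 / 2 < (x : ℝ) - 1 / ((k : ℝ) + 4) := by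
        have h0 : Tendsto (fun k : ℕ => (x : ℝ) - 1 / ((k : ℝ) + 4)) atTop (𝓝 ((x : ℝ) - 0)) :=
          tendsto_const_nhds.sub tendsto_one_div_add_four
        rw [sub_zero] at h0
        exact h0.eventually (lt_mem_nhds hlt)
      refine hev.mono fun k hk => ⟨by linarith [hpos k, hle k], ne_of_gt hk, by linarith [x.2.2, hpos k]⟩

/-- **Generic weights suffice**: if `OC5 · A o` holds for every generic weight vector then it holds
for all of them. [this work] -/
theorem OC5.of_generic (A : Finset (Fin n)) (o : Fin n)
    (h : ∀ w : Sym2 (Fin n) → unitInterval, Generic w → OC5 w A o) (w : Sym2 (Fin n) → unitInterval) :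
    OC5 w A o := by
  refine OC5.of_limit A o w (fun k e => nudge k (w e)) (tendsto_pi_nhds.2 fun e => nudge_tendsto (w e)) ?_
  have hall : ∀ᶠ k in atTop, ∀ e : Sym2 (Fin n),
      ((nudge k (w e) : ℝ) ≠ 0 ∧ (nudge k (w e) : ℝ) ≠ 1 / 2 ∧ (nudge k (w e) : ℝ) ≠ 1) :=
    Filter.eventually_all.2 fun e => nudge_eventually_generic (w e)
  exact hall.mono fun k hk => h _ fun e _ => hk e

end Summit.CriticalPhenomena.PercolationContinuityZ3.Theorems.OneCutCert
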